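import Literature.Computability.AlgebraicComplexity.Valiant3CNFMatrix
import Literature.LinearAlgebra.Matrix.PermanentZeroOneFlat
import HarnessLib

/-!
# Valiant's `0/1` matrix of a 3-CNF, flat and in closed form: `numSat = (per mod (2^q+1)) / 16^{3m}`

End of the mathematical part of Valiant's reduction `#3SAT → 0/1-permanent` (Valiant 1979,
Lemma 3.1, Lemma 3.3, Prop. 3.4, Thm. 1), in the closed form a polynomial-time machine can write
down. `Valiant3CNFMatrix.lean` gives the integer matrix `M3 ψ (7m) (3m)` of a 3-CNF `ψ` with `m`
clauses on the structured index type `I3 (7m) (3m)` and proves `per = 16^{3m} · numSat ψ`;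
`LinearAlgebra/Matrix/PermanentZeroOneFlat.lean` turns a `{-1,0,1,2,3}`-matrix given by a total entry
function into a flat `0/1` matrix `flat f n q` with `per M = per (flat) mod (2^q + 1)`. Here:

* `lay3 m : Fin (34m) ≃ I3 (7m) (3m)` — the flat layout of the integer matrix (original indices
  `< 7m`; the eight indices `L_{o,0..3}, R_{o,0..3}` of occurrence `o` at `7m + 8o + e`; the control
  slot of occurrence `o` at `31m + o`) and its value lemmas;
* `Valiant3CNF.mz ψ x y` — the integer entry at flat indices `x, y` by division with remainder
  (`mz_eq : M3 ψ (7m) (3m) (lay3 m x) (lay3 m y) = mz ψ x y`); `mz_mem` (values in `{-1,0,1,2,3}`);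
* `Valiant3CNF.valiant01 ψ := flat (mz ψ) (34m) (15m)`, a `0/1` matrix of size
  `34m + (34m)² (15m + 2)` (`valiant01_zero_one`), and the **final identity** `numSat_eq`:
  for every 3-CNF `ψ` over `ℕ`,
  `numSat ψ = (per (valiant01 ψ) mod (2^{15m} + 1)) / 16^{3m}`
  (`per (M3) = 16^{3m} numSat ψ ≤ 16^{3m} 2^{3m} = 2^{15m}` since `ψ` has at most `3m` variables).

## References

* L. G. Valiant, *The complexity of computing the permanent*, Theoret. Comput. Sci. 8 (1979)
  189–201: Lemma 3.1, Lemma 3.3, Prop. 3.4, Thm. 1 (pp. 193–194).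
* C. H. Papadimitriou, *Computational Complexity*, Addison-Wesley 1994, Thm. 18.3 (proof).
-/

noncomputable section

open Matrix Finset

namespace Literature.Computability.AlgebraicComplexity

open Literature.Computability.Complexity Literature.LinearAlgebra.Matrix CNFPer ValiantAll

namespace Valiant3CNF

/-! ### The flat layout of the integer matrix -/

section Layout

/-- `Fin 8 ≃ Fin 4 ⊕ Fin 4` (the `L`- and `R`-halves of an occurrence block). [folklore] -/
def eight : Fin 8 ≃ Fin 4 ⊕ Fin 4 := (finSumFinEquiv (m := 4) (n := 4)).symm

/-- **The flat layout** `Fin (34m) ≃ I3 (7m) (3m)`: original indices first, then `8` indices per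
occurrence (`L_{o,p}` at `7m + 8o + p`, `R_{o,p}` at `7m + 8o + 4 + p`), then one control slot per
occurrence at `31m + o`. [folklore] -/
def lay3 (m : ℕ) : Fin (34 * m) ≃ I3 (7 * m) (3 * m) :=
  (finCongr (by ring : 34 * m = 7 * m + (3 * m * 8 + 3 * m))).trans <|
    finSumFinEquiv.symm.trans (Equiv.sumCongr (Equiv.refl _)
      (finSumFinEquiv.symm.trans (Equiv.sumCongr
        (finProdFinEquiv.symm.trans (Equiv.prodCongr (Equiv.refl _) eight)) (Equiv.refl _))))

/-- The flat position of an original index. [folklore] -/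
@[simp] theorem lay3_symm_o (m : ℕ) (r : Fin (7 * m)) : ((lay3 m).symm (Sum.inl r)).val = r.val := by
  simp [lay3, finSumFinEquiv]

/-- The flat position of `L_{o,p}`: `7m + 8o + p`. [folklore] -/
@[simp] theorem lay3_symm_L (m : ℕ) (o : Fin (3 * m)) (p : Fin 4) :
    ((lay3 m).symm (Sum.inr (Sum.inl (o, Sum.inl p)))).val = 7 * m + 8 * o.val + p.val := by
  simp [lay3, eight, finSumFinEquiv, finProdFinEquiv]
  ring

/-- The flat position of `R_{o,p}`: `7m + 8o + 4 + p`. [folklore] -/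
@[simp] theorem lay3_symm_R (m : ℕ) (o : Fin (3 * m)) (p : Fin 4) :
    ((lay3 m).symm (Sum.inr (Sum.inl (o, Sum.inr p)))).val = 7 * m + 8 * o.val + 4 + p.val := by
  simp [lay3, eight, finSumFinEquiv, finProdFinEquiv]
  ring

/-- The flat position of the control slot of occurrence `o`: `31m + o`. [folklore] -/
@[simp] theorem lay3_symm_C (m : ℕ) (o : Fin (3 * m)) :
    ((lay3 m).symm (Sum.inr (Sum.inr o))).val = 31 * m + o.val := by
  simp [lay3, eight, finSumFinEquiv, finProdFinEquiv]
  ring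

/-- `lay3` on an original index. [folklore] -/
theorem lay3_orig (m : ℕ) (x : Fin (34 * m)) (h : x.val < 7 * m) : lay3 m x = Sum.inl ⟨x.val, h⟩ := by
  rw [Equiv.apply_eq_iff_eq_symm_apply]
  exact Fin.ext (by rw [lay3_symm_o])

/-- `lay3` on an `L`-index: `7m + 8o + e`, `e < 4`. [folklore] -/
theorem lay3_L (m : ℕ) (x : Fin (34 * m)) (h1 : 7 * m ≤ x.val) (h2 : x.val < 31 * m)
    (he : (x.val - 7 * m) % 8 < 4) :
    lay3 m x = Sum.inr (Sum.inl (⟨(x.val - 7 * m) / 8, by omega⟩, Sum.inl ⟨(x.val - 7 * m) % 8, he⟩)) := by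
  rw [Equiv.apply_eq_iff_eq_symm_apply]
  apply Fin.ext
  rw [lay3_symm_L]
  simp only
  omega

/-- `lay3` on an `R`-index: `7m + 8o + e`, `4 ≤ e < 8`. [folklore] -/
theorem lay3_R (m : ℕ) (x : Fin (34 * m)) (h1 : 7 * m ≤ x.val) (h2 : x.val < 31 * m)
    (he : 4 ≤ (x.val - 7 * m) % 8) :
    lay3 m x = Sum.inr (Sum.inl (⟨(x.val - 7 * m) / 8, by omega⟩,
      Sum.inr ⟨(x.val - 7 * m) % 8 - 4, by omega⟩)) := by
  rw [Equiv.apply_eq_iff_eq_symm_apply]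
  apply Fin.ext
  rw [lay3_symm_R]
  simp only
  omega

/-- `lay3` on a control slot: `31m + o`. [folklore] -/
theorem lay3_C (m : ℕ) (x : Fin (34 * m)) (h : 31 * m ≤ x.val) :
    lay3 m x = Sum.inr (Sum.inr ⟨x.val - 31 * m, by omega⟩) := by
  rw [Equiv.apply_eq_iff_eq_symm_apply]
  apply Fin.ext
  rw [lay3_symm_C]
  simp only
  omega

end Layout

/-! ### The closed form of the flat integer matrix -/

section MZ

variable {ν : Type*}

/-- The Valiant matrix `V` as a table on naturals. [cite: BurgisserClausenShokrollahi1997, Thm. (21.29)] -/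
def vtab (a b : ℕ) : ℤ :=
  if a = 0 then (if b = 1 then 1 else if b = 2 ∨ b = 3 then -1 else 0)
  else if a = 1 then (if b = 1 then -1 else if b = 0 ∨ b = 2 ∨ b = 3 then 1 else 0)
  else if a = 2 then (if b = 1 ∨ b = 2 then 1 else if b = 3 then 2 else 0)
  else if a = 3 then (if b = 1 then 1 else if b = 2 then 3 else 0)
  else 0

/-- `valiantV = vtab`. [cite: BurgisserClausenShokrollahi1997, Thm. (21.29)] -/
theorem valiantV_eq_vtab (p p' : Fin 4) : valiantV (k := ℤ) p p' = vtab p.val p'.val := by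
  fin_cases p <;> fin_cases p' <;> rfl

/-- `vtab` has values in `{-1,0,1,2,3}`. [folklore] -/
theorem vtab_mem (a b : ℕ) : vtab a b = -1 ∨ vtab a b = 0 ∨ vtab a b = 1 ∨ vtab a b = 2 ∨ vtab a b = 3 := by
  unfold vtab; split_ifs <;> simp

/-- `locZ` has values in `{-1, 0, 1}`. [folklore] -/
theorem locZ_mem (ls : List (Literal ν)) (a b : ℕ) : locZ ls a b = -1 ∨ locZ ls a b = 0 ∨ locZ ls a b = 1 := by
  unfold locZ
  by_cases hb : b = 7
  · rw [if_pos hb]; split_ifs <;> simp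
  rw [if_neg hb]
  cases ls[(b - 1) / 2]? with
  | none => simp
  | some l =>
    dsimp only
    unfold litSZ litPZ
    split_ifs <;> simp

/-- `ent0` has values in `{-1, 0, 1}`. [folklore] -/
theorem ent0_mem (ψ : CNF ν) (r s : ℕ) : ent0 ψ r s = -1 ∨ ent0 ψ r s = 0 ∨ ent0 ψ r s = 1 := by
  unfold ent0; split_ifs <;> first | exact locZ_mem _ _ _ | simp

/-- `colR` has values in `{0, 1}`. [folklore] -/
theorem colR_mem (ψ : CNF ν) (r o : ℕ) : colR ψ r o = 0 ∨ colR ψ r o = 1 := by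
  unfold colR
  split_ifs <;> try simp
  cases lit? ψ o with
  | none => simp
  | some l =>
    dsimp only
    unfold litPZ
    split_ifs <;> simp

variable [DecidableEq ν]

/-- **The integer entry of Valiant's matrix at flat indices** `x, y < 34m`: decode both indices
(original `< 7m`; `L_{o,e}` / `R_{o,e-4}` at `7m + 8o + e`; control slot `31m + o`) and read the
corresponding case of `M3`. [cite: Valiant1979, Lemma 3.1] -/
def mz (ψ : CNF ν) (x y : ℕ) : ℤ :=
  if x < 7 * ψ.length then
    (if y < 7 * ψ.length then ent0 ψ x y
     else if y < 31 * ψ.length then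
       (if (y - 7 * ψ.length) % 8 < 4 then 0
        else if (y - 7 * ψ.length) % 8 - 4 = 3 then colR ψ x ((y - 7 * ψ.length) / 8) else 0)
     else 0)
  else if x < 31 * ψ.length then
    (if (x - 7 * ψ.length) % 8 < 4 then
      (if y < 7 * ψ.length then 0
       else if y < 31 * ψ.length then
         (if (y - 7 * ψ.length) % 8 < 4 then
           (if (x - 7 * ψ.length) / 8 = (y - 7 * ψ.length) / 8 then
              vtab ((x - 7 * ψ.length) % 8) ((y - 7 * ψ.length) % 8)
            else if (x - 7 * ψ.length) % 8 = 0 ∧ (y - 7 * ψ.length) % 8 = 3 ∧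
                isNext3 ψ ((x - 7 * ψ.length) / 8) ((y - 7 * ψ.length) / 8) then 1 else 0)
          else (if (x - 7 * ψ.length) / 8 = (y - 7 * ψ.length) / 8 ∧ (x - 7 * ψ.length) % 8 = 3 ∧
                  (y - 7 * ψ.length) % 8 - 4 = 0 then 1 else 0))
       else (if (x - 7 * ψ.length) % 8 = 0 ∧ isLast3 ψ (3 * ψ.length) ((x - 7 * ψ.length) / 8) ∧
               isFirst3 ψ (y - 31 * ψ.length) ∧
               var? ψ (y - 31 * ψ.length) = var? ψ ((x - 7 * ψ.length) / 8) then 1 else 0))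
     else
      (if y < 7 * ψ.length then
         (if (x - 7 * ψ.length) % 8 - 4 = 0 ∧ y = dpos ((x - 7 * ψ.length) / 8) then 1 else 0)
       else if y < 31 * ψ.length then
         (if (y - 7 * ψ.length) % 8 < 4 then
            (if (x - 7 * ψ.length) / 8 = (y - 7 * ψ.length) / 8 ∧ (x - 7 * ψ.length) % 8 - 4 = 3 ∧
                (y - 7 * ψ.length) % 8 = 0 then 1 else 0)
          else (if (x - 7 * ψ.length) / 8 = (y - 7 * ψ.length) / 8 then
                  vtab ((x - 7 * ψ.length) % 8 - 4) ((y - 7 * ψ.length) % 8 - 4) else 0))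
       else 0))
  else
    (if y < 7 * ψ.length then 0
     else if y < 31 * ψ.length then
       (if (y - 7 * ψ.length) % 8 < 4 then
          (if isFirst3 ψ (x - 31 * ψ.length) ∧ (y - 7 * ψ.length) / 8 = x - 31 * ψ.length ∧
              (y - 7 * ψ.length) % 8 = 3 then 1 else 0)
        else 0)
     else (if x - 31 * ψ.length = y - 31 * ψ.length then 1 else 0))

/-- **`M3` through the flat layout is `mz`.** [cite: Valiant1979, Lemma 3.1] -/
theorem mz_eq (ψ : CNF ν) (x y : Fin (34 * ψ.length)) :
    M3 ψ (7 * ψ.length) (3 * ψ.length) (lay3 ψ.length x) (lay3 ψ.length y) = mz ψ x.val y.val := by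
  have hxv := x.isLt
  have hyv := y.isLt
  unfold mz
  by_cases hx1 : x.val < 7 * ψ.length
  · rw [lay3_orig ψ.length x hx1, if_pos hx1]
    by_cases hy1 : y.val < 7 * ψ.length
    · rw [lay3_orig ψ.length y hy1, if_pos hy1]; rfl
    rw [if_neg hy1]
    by_cases hy2 : y.val < 31 * ψ.length
    · rw [if_pos hy2]
      by_cases he : (y.val - 7 * ψ.length) % 8 < 4
      · rw [lay3_L ψ.length y (not_lt.1 hy1) hy2 he, if_pos he]; rfl
      · rw [lay3_R ψ.length y (not_lt.1 hy1) hy2 (not_lt.1 he), if_neg he]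
        simp [M3, Fin.ext_iff]
    · rw [if_neg hy2, lay3_C ψ.length y (not_lt.1 hy2)]; rfl
  rw [if_neg hx1]
  by_cases hx2 : x.val < 31 * ψ.length
  · rw [if_pos hx2]
    by_cases he : (x.val - 7 * ψ.length) % 8 < 4
    · rw [lay3_L ψ.length x (not_lt.1 hx1) hx2 he, if_pos he]
      by_cases hy1 : y.val < 7 * ψ.length
      · rw [lay3_orig ψ.length y hy1, if_pos hy1]; rfl
      rw [if_neg hy1]
      by_cases hy2 : y.val < 31 * ψ.length
      · rw [if_pos hy2]
        by_cases he' : (y.val - 7 * ψ.length) % 8 < 4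
        · rw [lay3_L ψ.length y (not_lt.1 hy1) hy2 he', if_pos he']
          simp [M3, Fin.ext_iff, valiantV_eq_vtab]
        · rw [lay3_R ψ.length y (not_lt.1 hy1) hy2 (not_lt.1 he'), if_neg he']
          simp [M3, Fin.ext_iff]
      · rw [if_neg hy2, lay3_C ψ.length y (not_lt.1 hy2)]
        simp [M3, Fin.ext_iff]
    · rw [lay3_R ψ.length x (not_lt.1 hx1) hx2 (not_lt.1 he), if_neg he]
      by_cases hy1 : y.val < 7 * ψ.length
      · rw [lay3_orig ψ.length y hy1, if_pos hy1]
        simp [M3, Fin.ext_iff]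
      rw [if_neg hy1]
      by_cases hy2 : y.val < 31 * ψ.length
      · rw [if_pos hy2]
        by_cases he' : (y.val - 7 * ψ.length) % 8 < 4
        · rw [lay3_L ψ.length y (not_lt.1 hy1) hy2 he', if_pos he']
          simp [M3, Fin.ext_iff]
        · rw [lay3_R ψ.length y (not_lt.1 hy1) hy2 (not_lt.1 he'), if_neg he']
          simp [M3, Fin.ext_iff, valiantV_eq_vtab]
      · rw [if_neg hy2, lay3_C ψ.length y (not_lt.1 hy2)]; rfl
  · rw [if_neg hx2, lay3_C ψ.length x (not_lt.1 hx2)]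
    by_cases hy1 : y.val < 7 * ψ.length
    · rw [lay3_orig ψ.length y hy1, if_pos hy1]; rfl
    rw [if_neg hy1]
    by_cases hy2 : y.val < 31 * ψ.length
    · rw [if_pos hy2]
      by_cases he' : (y.val - 7 * ψ.length) % 8 < 4
      · rw [lay3_L ψ.length y (not_lt.1 hy1) hy2 he', if_pos he']
        simp [M3, Fin.ext_iff]
      · rw [lay3_R ψ.length y (not_lt.1 hy1) hy2 (not_lt.1 he'), if_neg he']; rfl
    · rw [if_neg hy2, lay3_C ψ.length y (not_lt.1 hy2)]
      simp [M3, Fin.ext_iff]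

/-- **The integer entries lie in `{-1, 0, 1, 2, 3}`** (Valiant 1979, Lemma 3.1: "matrices with
entries from `{-1, 0, 1, 2, 3}`"). [cite: Valiant1979, Lemma 3.1] -/
theorem mz_mem (ψ : CNF ν) (x y : ℕ) :
    mz ψ x y = -1 ∨ mz ψ x y = 0 ∨ mz ψ x y = 1 ∨ mz ψ x y = 2 ∨ mz ψ x y = 3 := by
  have h3 : ∀ z : ℤ, (z = -1 ∨ z = 0 ∨ z = 1) → (z = -1 ∨ z = 0 ∨ z = 1 ∨ z = 2 ∨ z = 3) := by
    intro z hz; rcases hz with h | h | h <;> simp [h]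
  have h2 : ∀ z : ℤ, (z = 0 ∨ z = 1) → (z = -1 ∨ z = 0 ∨ z = 1 ∨ z = 2 ∨ z = 3) := by
    intro z hz; rcases hz with h | h <;> simp [h]
  unfold mz
  split_ifs <;> first | exact h3 _ (ent0_mem _ _ _) | exact h2 _ (colR_mem _ _ _) | exact vtab_mem _ _ | simp

end MZ

/-! ### The `0/1` matrix and the final identity -/

section Final

variable (ψ : CNF ℕ)

/-- **Valiant's `0/1` matrix of a 3-CNF** `ψ` with `m` clauses: the flat `0/1` expansion
(`LinearAlgebra/Matrix/PermanentZeroOneFlat.lean`, parameter `q = 15m`) of the flat integer matrix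
`mz ψ` of size `34m`; size `34m + (34m)² (15m + 2)`. [cite: Valiant1979, Thm. 1] -/
def valiant01 : Matrix (Fin (34 * ψ.length + 34 * ψ.length * (34 * ψ.length) * (15 * ψ.length + 2)))
    (Fin (34 * ψ.length + 34 * ψ.length * (34 * ψ.length) * (15 * ψ.length + 2))) ℤ :=
  flat (mz ψ) (34 * ψ.length) (15 * ψ.length)

/-- Valiant's `0/1` matrix is a `0/1` matrix. [cite: Valiant1979, Thm. 1] -/
theorem valiant01_zero_one (x y : Fin (34 * ψ.length + 34 * ψ.length * (34 * ψ.length) * (15 * ψ.length + 2))) :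
    valiant01 ψ x y = 0 ∨ valiant01 ψ x y = 1 :=
  flat_zero_one _ _ _ _ _

/-- The flat integer matrix is a re-indexing of `M3`. [cite: Valiant1979, Lemma 3.1] -/
theorem ofFn_mz_eq : ofFn (mz ψ) (34 * ψ.length) =
    (M3 ψ (7 * ψ.length) (3 * ψ.length)).submatrix (lay3 ψ.length) (lay3 ψ.length) := by
  ext x y
  simp only [ofFn, Matrix.of_apply, Matrix.submatrix_apply, mz_eq]

/-- A 3-CNF with `m` clauses has at most `3m` variables. [folklore] -/
theorem card_vars_le (hw : CNF.IsWidthEq 3 ψ) : ψ.vars.card ≤ 3 * ψ.length := by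
  unfold CNF.vars
  refine (List.toFinset_card_le _).trans ?_
  rw [List.length_map, List.length_flatten]
  have : ∀ φ : CNF ℕ, CNF.IsWidthEq 3 φ → (φ.map List.length).sum = 3 * φ.length := by
    intro φ hφ
    induction φ with
    | nil => simp
    | cons c cs ih =>
      rw [List.map_cons, List.sum_cons, hφ c (by simp), ih (fun c' hc' => hφ c' (by simp [hc'])), List.length_cons]
      ring
  rw [this ψ hw]

/-- **The permanent of the flat integer matrix**: `16^{3m} · numSat ψ`, between `0` and `2^{15m}`. [cite: Valiant1979, Lemma 3.1] -/
theorem permanent_ofFn_mz (hw : CNF.IsWidthEq 3 ψ) :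
    (ofFn (mz ψ) (34 * ψ.length)).permanent = 16 ^ (3 * ψ.length) * (ψ.numSat : ℤ) := by
  rw [ofFn_mz_eq, Matrix.permanent_submatrix_equiv, permanent_M3 ψ hw]

/-- `16^{3m} numSat ψ ≤ 2^{15m}`. [folklore] -/
theorem bound_numSat (hw : CNF.IsWidthEq 3 ψ) :
    (16 : ℤ) ^ (3 * ψ.length) * (ψ.numSat : ℤ) ≤ 2 ^ (15 * ψ.length) := by
  have h1 : ψ.numSat ≤ 2 ^ (3 * ψ.length) :=
    (CNF.numSat_le ψ).trans (Nat.pow_le_pow_right (by norm_num) (card_vars_le ψ hw))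
  have h2 : (ψ.numSat : ℤ) ≤ 2 ^ (3 * ψ.length) := by exact_mod_cast h1
  calc (16 : ℤ) ^ (3 * ψ.length) * (ψ.numSat : ℤ) ≤ 16 ^ (3 * ψ.length) * 2 ^ (3 * ψ.length) :=
        mul_le_mul_of_nonneg_left h2 (by positivity)
    _ = 2 ^ (15 * ψ.length) := by
        rw [show (16 : ℤ) = 2 ^ 4 by norm_num, ← pow_mul, ← pow_add]; congr 1; ring

/-- **Valiant's reduction, mathematical part** (Valiant 1979, Thm. 1 via Lemma 3.1, Lemma 3.3,
Prop. 3.4, in the single-modulus form): for every 3-CNF `ψ` over `ℕ` with `m` clauses,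
`per (valiant01 ψ) mod (2^{15m} + 1) = 16^{3m} · numSat ψ`. [cite: Valiant1979, Thm. 1] -/
theorem permanent_valiant01_emod (hw : CNF.IsWidthEq 3 ψ) :
    (valiant01 ψ).permanent % (2 ^ (15 * ψ.length) + 1 : ℕ) = 16 ^ (3 * ψ.length) * (ψ.numSat : ℤ) := by
  rw [valiant01, emod_permanent_flat_eq (mz ψ) _ _ (fun i j => mz_mem ψ i j)
    (by rw [permanent_ofFn_mz ψ hw]; positivity) (by rw [permanent_ofFn_mz ψ hw]; exact bound_numSat ψ hw),
    permanent_ofFn_mz ψ hw]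

/-- **`numSat` from the `0/1` permanent**: `numSat ψ = (per (valiant01 ψ) mod (2^{15m}+1)) / 16^{3m}`
as natural numbers (`per ≥ 0`). [cite: Valiant1979, Thm. 1] -/
theorem numSat_eq (hw : CNF.IsWidthEq 3 ψ) :
    ψ.numSat = (valiant01 ψ).permanent.toNat % (2 ^ (15 * ψ.length) + 1) / 16 ^ (3 * ψ.length) := by
  have h := permanent_valiant01_emod ψ hw
  have h0 : 0 ≤ (valiant01 ψ).permanent := permanent_flat_nonneg _ _ _
  have h1 : ((valiant01 ψ).permanent.toNat : ℤ) = (valiant01 ψ).permanent := Int.toNat_of_nonneg h0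
  have h2 : (((valiant01 ψ).permanent.toNat % (2 ^ (15 * ψ.length) + 1) : ℕ) : ℤ) =
      16 ^ (3 * ψ.length) * (ψ.numSat : ℤ) := by
    rw [← h]; push_cast; rw [h1]
  have h3 : (valiant01 ψ).permanent.toNat % (2 ^ (15 * ψ.length) + 1) = 16 ^ (3 * ψ.length) * ψ.numSat := by
    exact_mod_cast h2
  rw [h3, Nat.mul_div_cancel_left _ (by positivity)]

end Final

end Valiant3CNF

end Literature.Computability.AlgebraicComplexity
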